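import Summits.ResolutionOfSingularities.ResolutionOfSingularities.Theorems.HomologicalConductorNoZenoParasiteLocPrime
import HarnessLib

/-!
# Crux `NoZenoR` / `NoZeno` (stmt-ResolutionOfSingularities-19943 / -16483), β-front structure:
# PARASITE VALUATION RINGS AND SINGULAR THREADS (III) — threadless towers, the thread dichotomy,
# cofinal contraction of the singular locus

Route `ResolutionOfSingularities/HomologicalConductor`.  OURS (cell res-hironaka: ideator
res-L0-w44-idea-1, round 6, `Sketch-idea-1-r6.lean` sha16 `6ae3bce5c33cc7eb` §g6.6–§g6.8; ported by
res-L0-w44-stub-2 per CHAIN W4.4 v10 §2 / note 40).  Nothing here is a statement of the manuscript under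
review; AI analysis, weaker than expert review.

With parts I–II (`…NoZenoParasite`, `…NoZenoParasiteLocPrime`):

* for `caIdeal O A m` = the ideal `ca(T_m)·T_m` of stage `m` and `singRad O A m` = its radical (the
  ideal of the singular locus of the stage; both part I): L2 `mem_singRad_succ` / `mem_singRad_of_le` —
  RADICAL PERSISTENCE
  (`ca (T_m) ⊆ √ca (T_(m+1))` elementwise — hypothesis `hPR`, the route's `PersistenceRadical` on this
  tower) pushes the singular radical UP the tower.
* L3 `singularPrimeThread_of_avoids` — THREAD CONSTRUCTION: a positive-value `s ∈ T_m` avoiding the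
  singular radical of every later stage yields a `SingularPrimeThread` (the ideal `⋃_M √(ca·T_M)` of
  `⋃ T_M` has `s` outside its radical; a prime over it avoiding `s` restricts to the thread).
* S2′ `eventuallyExceptionalSing_of_noThread`, S2 `threadlessOfExhausts_holds : ThreadlessOfExhausts`,
  C2 `stubExh_eventuallyExceptionalSing` (over the literal binders of `stub_kernelRankOneHighExh` +
  `hPR` + a nonzero centre): EVENTUALLY EXCEPTIONAL SINGULAR LOCI — the free structural hypothesis
  `hthr` of the Exh stub.
* D `thread_dichotomy` (rank-free, exhaustion-free): radical persistence + a nonzero centre ⟹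
  `SingularPrimeThread ∨ EventuallyExceptionalSing`.
* C3 `singularLocus_contracts_of_noThread` / `stubExh_singularLocus_contracts` — COFINAL CONTRACTION:
  `∀ m ∃ M ≥ m`, every singular point of `T_M` (prime `𝔮 ⊇ ca(T_M)`) lies over the centre of `O` on
  `T_m` (uses the stages' noetherianity, tree `stub_towerNoetherian`).

Pure-proof file: no definitions, no named facts, no new axioms, no sorry.
-/

noncomputable section

-- single-problem summit: the doubled namespace component `ResolutionOfSingularities` is forced
set_option linter.dupNamespace false

namespace Summit.ResolutionOfSingularities.ResolutionOfSingularities.Theorems.NoZeno.SandwichCluster.Parasite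

open Summit.ResolutionOfSingularities.ResolutionOfSingularities.Theorems.NoZeno.Birth
open Summit.ResolutionOfSingularities.ResolutionOfSingularities.Theorems
open Literature.AlgebraicGeometry.Resolution IsLocalRing Polynomial

variable {k K : Type} [Field k] [Field K] [Algebra k K]

/-! ## The singular radical of a stage and its persistence -/

/-- Centre elements lie in the singular radical. [this work] -/
theorem mem_singRad_of_mem_ca (O : ValuationSubring K) (A : Subalgebra k K) (m : ℕ) {c : K}
    (hc : c ∈ ca (tower O A m)) (hc' : c ∈ tower O A m) :
    (⟨c, hc'⟩ : ↥(tower O A m)) ∈ singRad O A m :=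
  Ideal.le_radical (Ideal.subset_span hc)

/-- Elements of `ca(T_m)·T_m` (the ideal) lie in the `T_m`-span of `ca(T_m)` inside `K`. [this work] -/
theorem coe_mem_span_ca_of_mem_caIdeal (O : ValuationSubring K) (A : Subalgebra k K) (m : ℕ)
    {y : ↥(tower O A m)} (hy : y ∈ caIdeal O A m) :
    (y : K) ∈ Submodule.span ↥(tower O A m) (ca (tower O A m)) := by
  induction hy using Submodule.span_induction with
  | mem x hx => exact Submodule.subset_span hx
  | zero => exact Submodule.zero_mem _
  | add x y _ _ hx hy =>
    rw [Subalgebra.coe_add]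
    exact Submodule.add_mem _ hx hy
  | smul a x _ hx =>
    have : ((a • x : ↥(tower O A m)) : K) = a • (x : K) := by
      rw [smul_eq_mul, Subalgebra.coe_mul, Subalgebra.smul_def, smul_eq_mul]
    rw [this]
    exact Submodule.smul_mem _ a hx

/-- **L2. Radical persistence pushes the singular radical UP one stage**:
`√(ca·T_m) ⊆ √(ca·T_(m+1)) ∩ T_m`. [this work] -/
theorem mem_singRad_succ (O : ValuationSubring K) (A : Subalgebra k K) (m : ℕ)
    (hPR : ∀ x ∈ ca (tower O A m), ∃ N : ℕ, 1 ≤ N ∧ x ^ N ∈ ca (tower O A (m + 1)))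
    {x : K} (hx : x ∈ tower O A m) (hx' : x ∈ tower O A (m + 1))
    (h : (⟨x, hx⟩ : ↥(tower O A m)) ∈ singRad O A m) :
    (⟨x, hx'⟩ : ↥(tower O A (m + 1))) ∈ singRad O A (m + 1) := by
  have hle : tower O A m ≤ tower O A (m + 1) := fun y hy =>
    d2rc_mem_tower_of_le O A (Nat.le_succ m) hy
  let ι : ↥(tower O A m) →ₐ[k] ↥(tower O A (m + 1)) := Subalgebra.inclusion hle
  -- generators of `caIdeal m` land in `singRad (m+1)`
  have hgen : caIdeal O A m ≤ (singRad O A (m + 1)).comap ι := by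
    rw [caIdeal, Ideal.span_le]
    rintro c hc
    obtain ⟨N, -, hN⟩ := hPR c hc
    rw [SetLike.mem_coe, Ideal.mem_comap, singRad, Ideal.mem_radical_iff]
    refine ⟨N, ?_⟩
    have : (ι c) ^ N = ⟨(c : K) ^ N, ca_subset _ hN⟩ := Subtype.ext (by simp [ι])
    rw [this]
    exact Ideal.subset_span hN
  obtain ⟨n, hn⟩ := Ideal.mem_radical_iff.mp h
  have h1 : ι (⟨x, hx⟩ ^ n) ∈ singRad O A (m + 1) := hgen hn
  have h2 : ι (⟨x, hx⟩ ^ n) = (⟨x, hx'⟩ : ↥(tower O A (m + 1))) ^ n := by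
    rw [map_pow]; rfl
  rw [h2] at h1
  have : (⟨x, hx'⟩ : ↥(tower O A (m + 1))) ∈ (singRad O A (m + 1)).radical :=
    Ideal.mem_radical_iff.mpr ⟨n, h1⟩
  rwa [singRad, Ideal.radical_idem] at this

/-- L2 iterated: `√(ca·T_m) ⊆ √(ca·T_M) ∩ T_m` for `m ≤ M`. [this work] -/
theorem mem_singRad_of_le (O : ValuationSubring K) (A : Subalgebra k K)
    (hPR : ∀ m : ℕ, ∀ x ∈ ca (tower O A m), ∃ N : ℕ, 1 ≤ N ∧ x ^ N ∈ ca (tower O A (m + 1)))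
    {m M : ℕ} (hmM : m ≤ M) {x : K} (hx : x ∈ tower O A m) (hx' : x ∈ tower O A M)
    (h : (⟨x, hx⟩ : ↥(tower O A m)) ∈ singRad O A m) :
    (⟨x, hx'⟩ : ↥(tower O A M)) ∈ singRad O A M := by
  induction M, hmM using Nat.le_induction with
  | base => exact h
  | succ M hmM ih =>
    have hxM : x ∈ tower O A M := d2rc_mem_tower_of_le O A hmM hx
    exact mem_singRad_succ O A M (hPR M) hxM hx' (ih hxM)

/-! ## S2: a non-exceptional element threads the tower -/

/-- **L3. Thread construction.** If some `s ∈ T_m` of positive value avoids the singular radical of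
every later stage, the tower carries a singular prime thread (prime avoidance in `⋃ T_m`). [this work] -/
theorem singularPrimeThread_of_avoids (O : ValuationSubring K) (A : Subalgebra k K)
    (hPR : ∀ m : ℕ, ∀ x ∈ ca (tower O A m), ∃ N : ℕ, 1 ≤ N ∧ x ^ N ∈ ca (tower O A (m + 1)))
    (hne : ∃ m, ∃ x ∈ ca (tower O A m), x ≠ 0)
    {m : ℕ} {s : K} (hs : s ∈ tower O A m) (hvs : O.valuation s < 1)
    (havoid : ∀ M : ℕ, m ≤ M → ∀ hs' : s ∈ tower O A M,
      (⟨s, hs'⟩ : ↥(tower O A M)) ∉ singRad O A M) :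
    SingularPrimeThread O A := by
  classical
  -- the union `U` of the stages
  let R : ℕ → Subring K := fun i => (tower O A i).toSubring
  have hmonoT : ∀ {i j : ℕ}, i ≤ j → ∀ {x : K}, x ∈ tower O A i → x ∈ tower O A j :=
    fun hij x hx => d2rc_mem_tower_of_le O A hij hx
  have hmono : Monotone R := monotone_nat_of_le_succ fun i x hx => hmonoT (Nat.le_succ i) hx
  set U : Subring K := ⨆ i, R i with hU
  have hdir : Directed (· ≤ ·) R := hmono.directed_le
  have hmemU : ∀ x, x ∈ U ↔ ∃ i, x ∈ tower O A i := fun x => Subring.mem_iSup_of_directed hdir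
  have hTU : ∀ i {x : K}, x ∈ tower O A i → x ∈ U := fun i x hx => (hmemU x).mpr ⟨i, hx⟩
  -- the ideal `Q = ⋃ √(ca·T_M)` of `U`
  let Q : Ideal ↥U :=
    { carrier := {y | ∃ (M : ℕ) (hy : (y : K) ∈ tower O A M), (⟨y, hy⟩ : ↥(tower O A M)) ∈ singRad O A M}
      zero_mem' := ⟨0, (tower O A 0).zero_mem, by
        have : (⟨((0 : ↥U) : K), (tower O A 0).zero_mem⟩ : ↥(tower O A 0)) = 0 := Subtype.ext rfl
        rw [this]; exact Ideal.zero_mem _⟩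
      add_mem' := by
        rintro y z ⟨M₁, hy, h1⟩ ⟨M₂, hz, h2⟩
        refine ⟨max M₁ M₂, (tower O A _).add_mem (hmonoT (le_max_left _ _) hy)
          (hmonoT (le_max_right _ _) hz), ?_⟩
        have h1' := mem_singRad_of_le O A hPR (le_max_left M₁ M₂) hy (hmonoT (le_max_left _ _) hy) h1
        have h2' := mem_singRad_of_le O A hPR (le_max_right M₁ M₂) hz (hmonoT (le_max_right _ _) hz) h2
        have : (⟨((y + z : ↥U) : K), _⟩ : ↥(tower O A (max M₁ M₂))) =
            ⟨(y : K), hmonoT (le_max_left _ _) hy⟩ + ⟨(z : K), hmonoT (le_max_right _ _) hz⟩ :=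
          Subtype.ext rfl
        rw [this]
        exact Ideal.add_mem _ h1' h2'
      smul_mem' := by
        rintro c y ⟨M₁, hy, h1⟩
        obtain ⟨M₂, hc⟩ := (hmemU c).mp c.2
        refine ⟨max M₁ M₂, (tower O A _).mul_mem (hmonoT (le_max_right _ _) hc)
          (hmonoT (le_max_left _ _) hy), ?_⟩
        have h1' := mem_singRad_of_le O A hPR (le_max_left M₁ M₂) hy (hmonoT (le_max_left _ _) hy) h1
        have : (⟨((c • y : ↥U) : K), _⟩ : ↥(tower O A (max M₁ M₂))) =
            ⟨(c : K), hmonoT (le_max_right _ _) hc⟩ * ⟨(y : K), hmonoT (le_max_left _ _) hy⟩ :=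
          Subtype.ext rfl
        rw [this]
        exact Ideal.mul_mem_left _ _ h1' }
  have hmemQ : ∀ y : ↥U, y ∈ Q ↔
      ∃ (M : ℕ) (hy : (y : K) ∈ tower O A M), (⟨y, hy⟩ : ↥(tower O A M)) ∈ singRad O A M :=
    fun y => Iff.rfl
  -- `s ∉ √Q`
  have hsU : s ∈ U := hTU m hs
  have hsrad : (⟨s, hsU⟩ : ↥U) ∉ Q.radical := by
    rintro ⟨n, hn⟩
    obtain ⟨M, hy, hM⟩ := (hmemQ _).mp hn
    have hsM' : s ∈ tower O A (max M m) := hmonoT (le_max_right _ _) hs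
    have hy' : s ^ n ∈ tower O A (max M m) := hmonoT (le_max_left _ _) hy
    have h1 := mem_singRad_of_le O A hPR (le_max_left M m) hy hy' hM
    have h2 : (⟨(((⟨s, hsU⟩ : ↥U) ^ n : ↥U) : K), hy'⟩ : ↥(tower O A (max M m))) = ⟨s, hsM'⟩ ^ n :=
      Subtype.ext (by simp)
    rw [h2] at h1
    have h3 : (⟨s, hsM'⟩ : ↥(tower O A (max M m))) ∈ (singRad O A (max M m)).radical :=
      Ideal.mem_radical_iff.mpr ⟨n, h1⟩
    rw [singRad, Ideal.radical_idem] at h3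
    exact havoid (max M m) (le_max_right _ _) hsM' h3
  -- a prime `𝔮 ⊇ Q` of `U` avoiding `s`
  obtain ⟨𝔮, ⟨hQ𝔮, h𝔮⟩, hs𝔮⟩ : ∃ J : Ideal ↥U, (Q ≤ J ∧ J.IsPrime) ∧ (⟨s, hsU⟩ : ↥U) ∉ J := by
    by_contra hcon
    push Not at hcon
    apply hsrad
    rw [Ideal.radical_eq_sInf, Submodule.mem_sInf]
    exact fun J hJ => hcon J hJ
  -- restrict to the stages
  let f : ∀ j : ℕ, ↥(tower O A j) →+* ↥U := fun j =>
    { toFun := fun x => ⟨x, hTU j x.2⟩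
      map_one' := rfl
      map_mul' := fun _ _ => rfl
      map_zero' := rfl
      map_add' := fun _ _ => rfl }
  haveI := h𝔮
  refine ⟨fun j => 𝔮.comap (f j), fun j => Ideal.IsPrime.comap _, fun j x hx hx' => Iff.rfl,
    fun j x hx hxca => ?_, hne, ⟨m, s, hs, hvs, hs𝔮⟩⟩
  rw [Ideal.mem_comap]
  exact hQ𝔮 ((hmemQ _).mpr ⟨j, hx, mem_singRad_of_mem_ca O A j hxca hx⟩)

/-- **S2′.** Exceptionality from threadlessness: if the tower has radical persistence
and no singular prime thread, every positive-value element is eventually exceptional for the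
singular locus. [this work] -/
theorem eventuallyExceptionalSing_of_noThread (O : ValuationSubring K) (A : Subalgebra k K)
    (hPR : ∀ m : ℕ, ∀ x ∈ ca (tower O A m), ∃ N : ℕ, 1 ≤ N ∧ x ^ N ∈ ca (tower O A (m + 1)))
    (hne : ∃ m, ∃ x ∈ ca (tower O A m), x ≠ 0) (hthr : ¬ SingularPrimeThread O A) :
    EventuallyExceptionalSing O A := by
  intro m s hs hvs
  by_contra hcon
  push Not at hcon
  apply hthr
  refine singularPrimeThread_of_avoids O A hPR hne hs hvs fun M hmM hs' hmem => ?_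
  obtain ⟨n, hn⟩ := Ideal.mem_radical_iff.mp hmem
  have hn1 : (⟨s, hs'⟩ : ↥(tower O A M)) ^ (n + 1) ∈ caIdeal O A M := by
    rw [pow_succ']
    exact Ideal.mul_mem_left _ _ hn
  have := coe_mem_span_ca_of_mem_caIdeal O A M hn1
  rw [Subalgebra.coe_pow] at this
  exact hcon M hmM n this

/-- **S2.** `ThreadlessOfExhausts` (part I) holds: an exhaustive rank-one tower with radical persistence and a
nonzero centre has eventually exceptional singular loci (no thread by C1′, then S2′). [this work] -/
theorem threadlessOfExhausts_holds : ThreadlessOfExhausts := by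
  intro k K _ _ _ O A hk hAO hPR hrk hexh hne
  exact eventuallyExceptionalSing_of_noThread O A hPR hne
    (fun hthr => not_exhausts_of_singularPrimeThread O A hk hAO hrk hthr hexh)

/-- **C2 (over the literal hypotheses of `stub_kernelRankOneHighExh` + the route's `PersistenceRadical`
instance on this tower).** EVENTUALLY EXCEPTIONAL SINGULAR LOCI in the Exh regime: for every stage element
`s` of positive `O`-value, from some later stage on the singular locus `V(ca(T_m'))` lies inside `{s = 0}`
(`s ∈ √(ca(T_m')·T_m')`, typed as `s^(N+1) ∈ ca(T_m')·T_m'`). Free structure for the Exh stub. [this work] -/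
theorem stubExh_eventuallyExceptionalSing (O : ValuationSubring K) (A : Subalgebra k K)
    (hk : ∀ c : k, algebraMap k K c ∈ O) (hAO : A.toSubring ≤ O.toSubring)
    (hrk : ∀ O' : ValuationSubring K, O ≤ O' → O' = O ∨ O' = ⊤)
    (hexh : ∀ x : K, x ∈ O → ∃ m : ℕ, x ∈ tower O A m)
    (hPR : ∀ m : ℕ, ∀ x ∈ ca (tower O A m), ∃ N : ℕ, 1 ≤ N ∧ x ^ N ∈ ca (tower O A (m + 1)))
    (hne : ∃ m, ∃ x ∈ ca (tower O A m), x ≠ 0) :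
    EventuallyExceptionalSing O A :=
  threadlessOfExhausts_holds k K O A hk hAO hPR hrk hexh hne

/-- **D (the THREAD DICHOTOMY, rank-free, exhaustion-free).** Every tower with radical
persistence and a nonzero centre is either THREADED (a singular curve through the centres, never resolved
at its generic point — hence, for rank-one `O`, non-exhaustive by T4′) or has EVENTUALLY EXCEPTIONAL
singular loci. [this work] -/
theorem thread_dichotomy (O : ValuationSubring K) (A : Subalgebra k K)
    (hPR : ∀ m : ℕ, ∀ x ∈ ca (tower O A m), ∃ N : ℕ, 1 ≤ N ∧ x ^ N ∈ ca (tower O A (m + 1)))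
    (hne : ∃ m, ∃ x ∈ ca (tower O A m), x ≠ 0) :
    SingularPrimeThread O A ∨ EventuallyExceptionalSing O A := by
  by_cases h : SingularPrimeThread O A
  · exact Or.inl h
  · exact Or.inr (eventuallyExceptionalSing_of_noThread O A hPR hne h)

/-! ## Cofinal contraction of the singular locus onto the valuation's track (Exh regime) -/

/-- Internal form of exceptionality: a threadless tower with radical persistence puts every
positive-value stage element into the singular radical of some later stage. [this work] -/
theorem exists_mem_singRad_of_noThread (O : ValuationSubring K) (A : Subalgebra k K)
    (hPR : ∀ m : ℕ, ∀ x ∈ ca (tower O A m), ∃ N : ℕ, 1 ≤ N ∧ x ^ N ∈ ca (tower O A (m + 1)))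
    (hne : ∃ m, ∃ x ∈ ca (tower O A m), x ≠ 0) (hthr : ¬ SingularPrimeThread O A)
    {m : ℕ} {s : K} (hs : s ∈ tower O A m) (hvs : O.valuation s < 1) :
    ∃ M : ℕ, m ≤ M ∧ ∀ hs' : s ∈ tower O A M, (⟨s, hs'⟩ : ↥(tower O A M)) ∈ singRad O A M := by
  by_contra hcon
  push Not at hcon
  exact hthr (singularPrimeThread_of_avoids O A hPR hne hs hvs fun M hmM hs' hmem => by
    obtain ⟨hs'', h⟩ := hcon M hmM
    exact h hmem)

/-- **C3 (literal Exh-stub hypotheses + the tower's radical persistence + `A` f.g. with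
`Frac A = K`).** COFINAL CONTRACTION OF THE SINGULAR LOCUS: for every stage `m` there is a later stage
`M` at which every singular point (prime `𝔮 ⊇ ca(T_M)`) lies over the centre of `O` on `T_m`
(`𝔮 ∩ T_m ⊇ 𝔪_O ∩ T_m`). Away from the valuation's own track the exhaustive tower RESOLVES. [this work] -/
theorem singularLocus_contracts_of_noThread (O : ValuationSubring K) (A : Subalgebra k K)
    (hk : ∀ c : k, algebraMap k K c ∈ O) (hA : A.FG) (hfr : IsFractionRing ↥A K)
    (hAO : A.toSubring ≤ O.toSubring)
    (hPR : ∀ m : ℕ, ∀ x ∈ ca (tower O A m), ∃ N : ℕ, 1 ≤ N ∧ x ^ N ∈ ca (tower O A (m + 1)))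
    (hne : ∃ m, ∃ x ∈ ca (tower O A m), x ≠ 0) (hthr : ¬ SingularPrimeThread O A) (m : ℕ) :
    ∃ M : ℕ, m ≤ M ∧ ∀ (𝔮 : Ideal ↥(tower O A M)), 𝔮.IsPrime →
      (∀ (c : K) (hc : c ∈ tower O A M), c ∈ ca (tower O A M) → (⟨c, hc⟩ : ↥(tower O A M)) ∈ 𝔮) →
      ∀ (x : K) (hx : x ∈ tower O A m) (hx' : x ∈ tower O A M), O.valuation x < 1 →
        (⟨x, hx'⟩ : ↥(tower O A M)) ∈ 𝔮 := by
  classical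
  haveI : IsNoetherianRing ↥(tower O A m) := stub_towerNoetherian k K O A hk hA hfr hAO m
  have hTO : ∀ x : K, x ∈ tower O A m → x ∈ O := fun x hx =>
    (tn_tower_invariant O A hk hA hfr hAO m).2.1 hx
  have hmonoT : ∀ {i j : ℕ}, i ≤ j → ∀ {x : K}, x ∈ tower O A i → x ∈ tower O A j :=
    fun hij x hx => d2rc_mem_tower_of_le O A hij hx
  -- the centre prime of `O` on stage `m`
  let P : Ideal ↥(tower O A m) :=
    { carrier := {x | O.valuation (x : K) < 1}
      zero_mem' := by simp
      add_mem' := fun {x y} hx hy => by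
        simp only [Set.mem_setOf_eq, Subalgebra.coe_add] at hx hy ⊢
        exact lt_of_le_of_lt (Valuation.map_add _ _ _) (max_lt hx hy)
      smul_mem' := fun c {x} hx => by
        simp only [Set.mem_setOf_eq, smul_eq_mul, Subalgebra.coe_mul, map_mul] at hx ⊢
        have hc : O.valuation (c : K) ≤ 1 := (O.valuation_le_one_iff _).mpr (hTO _ c.2)
        calc O.valuation (c : K) * O.valuation (x : K)
            ≤ 1 * O.valuation (x : K) := mul_le_mul_left hc _
          _ < 1 := by rw [one_mul]; exact hx }
  have hmemP : ∀ x : ↥(tower O A m), x ∈ P ↔ O.valuation (x : K) < 1 := fun x => Iff.rfl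
  obtain ⟨G, hG⟩ := (isNoetherian_def.mp (inferInstance : IsNoetherian ↥(tower O A m) ↥(tower O A m))) P
  have hGP : ∀ g ∈ G, g ∈ P := fun g hg => hG ▸ Submodule.subset_span hg
  have hex : ∀ g : ↥(tower O A m), O.valuation (g : K) < 1 →
      ∃ M : ℕ, m ≤ M ∧ ∀ hs' : (g : K) ∈ tower O A M, (⟨g, hs'⟩ : ↥(tower O A M)) ∈ singRad O A M :=
    fun g hg => exists_mem_singRad_of_noThread O A hPR hne hthr g.2 hg
  choose! Mg hMg using hex
  have hle : tower O A m ≤ tower O A (max m (G.sup Mg)) := fun y hy => hmonoT (le_max_left _ _) hy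
  refine ⟨max m (G.sup Mg), le_max_left _ _, fun 𝔮 h𝔮 hca x hx hx' hvx => ?_⟩
  let ι : ↥(tower O A m) →ₐ[k] ↥(tower O A (max m (G.sup Mg))) := Subalgebra.inclusion hle
  have hrad : singRad O A (max m (G.sup Mg)) ≤ 𝔮 := by
    rw [singRad, Ideal.IsPrime.radical_le_iff h𝔮, caIdeal, Ideal.span_le]
    rintro c hc
    simpa using hca c c.2 hc
  have hGq : ∀ g ∈ G, ι g ∈ 𝔮 := fun g hg => by
    obtain ⟨hmMg, hsing⟩ := hMg g ((hmemP g).mp (hGP g hg))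
    have hMgM : Mg g ≤ max m (G.sup Mg) := le_trans (Finset.le_sup hg) (le_max_right _ _)
    have h1 := mem_singRad_of_le O A hPR hMgM (hmonoT hmMg g.2) (hle g.2) (hsing _)
    exact hrad h1
  have hPq : P ≤ 𝔮.comap ι := by
    rw [← hG]
    exact Submodule.span_le.mpr fun g hg => hGq g hg
  have hxP : (⟨x, hx⟩ : ↥(tower O A m)) ∈ P := hvx
  exact hPq hxP

/-- **C3′ (over the literal hypotheses of `stub_kernelRankOneHighExh` + radical persistence).**
In the exhaustive rank-one kernel regime the singular locus CONTRACTS COFINALLY onto the valuation's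
track: `∀ m, ∃ M ≥ m`, every singular point of `T_M` lies over the centre of `O` on `T_m`. [this work] -/
theorem stubExh_singularLocus_contracts (O : ValuationSubring K) (A : Subalgebra k K)
    (hk : ∀ c : k, algebraMap k K c ∈ O) (hA : A.FG) (hfr : IsFractionRing ↥A K)
    (hAO : A.toSubring ≤ O.toSubring)
    (hrk : ∀ O' : ValuationSubring K, O ≤ O' → O' = O ∨ O' = ⊤)
    (hexh : ∀ x : K, x ∈ O → ∃ m : ℕ, x ∈ tower O A m)
    (hPR : ∀ m : ℕ, ∀ x ∈ ca (tower O A m), ∃ N : ℕ, 1 ≤ N ∧ x ^ N ∈ ca (tower O A (m + 1)))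
    (hne : ∃ m, ∃ x ∈ ca (tower O A m), x ≠ 0) (m : ℕ) :
    ∃ M : ℕ, m ≤ M ∧ ∀ (𝔮 : Ideal ↥(tower O A M)), 𝔮.IsPrime →
      (∀ (c : K) (hc : c ∈ tower O A M), c ∈ ca (tower O A M) → (⟨c, hc⟩ : ↥(tower O A M)) ∈ 𝔮) →
      ∀ (x : K) (hx : x ∈ tower O A m) (hx' : x ∈ tower O A M), O.valuation x < 1 →
        (⟨x, hx'⟩ : ↥(tower O A M)) ∈ 𝔮 :=
  singularLocus_contracts_of_noThread O A hk hA hfr hAO hPR hne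
    (stubExh_noSingularPrimeThread O A hk hAO hrk hexh) m
end Summit.ResolutionOfSingularities.ResolutionOfSingularities.Theorems.NoZeno.SandwichCluster.Parasite

end
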